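import Summits.BirchSwinnertonDyer.BirchSwinnertonDyer.Theorems.BiquadraticEisensteinDescentHeegnerTwistCouplingInSupplyHeavySparse
import Literature.NumberTheory.EllipticCurves.Rank1Residual.Predicates
import Literature.NumberTheory.EllipticCurves.QuadraticTwist
import Literature.NumberTheory.EllipticCurves.GlobalMinimalModel
import HarnessLib

set_option linter.dupNamespace false -- `Summit.BirchSwinnertonDyer.BirchSwinnertonDyer.Theorems.…` (summit = sub, D-0017)
set_option autoImplicit false

/-!
# Crux `HeegnerTwistCouplingInSupply` (stmt-BirchSwinnertonDyer-21381), card `heavy-discriminant-sparsity` —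
# §C THE DENSITY DOOR: positive-density non-vanishing of Heegner twists at scale `A·p²` ⟹ the crux's conclusion,
# with the class-number conjunct `p ∤ h(K′)` DISCHARGED (W-uniformly, for `p ≥ p₂(A, δ)`)

Route `BiquadraticEisensteinDescent` (cell `pub/bsd-wall`; width seat `bsd-wall-cm-bed-w4` g29; THEOREMS ONLY,
`--supports 21381`). Third file of the unit «HEAVY-DISCRIMINANT SPARSITY + DENSITY DOOR» (crux idea
`Cruxes/HeegnerTwistCouplingInSupply/Ideas/heavy-discriminant-sparsity.md`, ideation seat 1 g37: `door_shape`, `BulkTransfer`).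
The crux asks, at `(W, p)`, for ONE imaginary quadratic Heegner field `K′` of `N_W` with `|d_{K′}| > 4`, `L(W^{(d_{K′})}, 1) ≠ 0`
AND `p ∤ h(K′)`. With §B (`heavySparse_window`: heavy discriminants are `≤ η·A·p²` of the window `[−A·p², −1]` for
`p ≥ p₀(A, η)`) the AND becomes a PIGEONHOLE: if the non-vanishing Heegner discriminants of `N_W` have density `≥ δ` in the
window, one of them is LIGHT (`h_{K′} < 2^{ω(|d|)−1}·p`), hence `p ∤ h(K′)` by genus theory (`not_dvd_classNumber_of_light`).

* `cruxConclusion_of_light` — the card's `door_shape`: one light non-vanishing Heegner field gives the conclusion at `(W, p)`;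
* `cruxConclusion_of_card_heavy_lt_card` — the pigeonhole in a fixed window `[−X, −1]`: `#heavy < #non-vanishing ⟹` conclusion;
* ★★ `cruxConclusion_of_window_density` — THE DENSITY DOOR: for every `A ≥ 1`, `δ > 0` there is `p₂ = p₂(A, δ)` such that for
  EVERY `W/ℚ` and every odd prime `p ≥ p₂`: if at least `δ·A·p²` integers `d ∈ [−A·p², −1]` are discriminants of Heegner
  fields `K′` of `N_W` with `|d| > 4` and `L(W^{(d)}, 1) ≠ 0`, then the crux's conclusion holds at `(W, p)` — no hypothesis on
  class numbers, no relation between `W` and `p` needed;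
* `bulkTransfer` — the card's `BulkTransfer` on any corner class `𝒞` (absolute form of `PropNVAtScale` ⟹ conclusion on `𝒞`
  for `p ≥ p₂`), and `cruxBody_of_window_density` — the same with the crux's own (idle) hypothesis list, by-name shape.

HONEST FRAMING: a DOOR. Its input — positive-density non-vanishing of the Heegner quadratic twists of `W` in the window
`|d| ≤ A·p²`, uniformly on a corner class (the card's `PropNVAtScale`; for the Sylvester corner a Davenport–Heilbronn count
with one Frobenius condition at `p`, card §INSTANCE) — is OPEN and is NOT asserted here; `p₂` is ineffective (§B); the small
`p < p₂` of a class remain table work. C⁺ (`stub_nonNullIndivisibleHeegner`), `stub_printedInputsDensityOne`, crux 21381 and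
BSD are NOT proved by any of this. [cite: Cox2013, §3.B Thm. 3.15]
-/

noncomputable section

open scoped Classical
open Finset
open WeierstrassCurve
open Literature.NumberTheory.EllipticCurves Literature.NumberTheory.EllipticCurves.Rank1Residual

namespace Summit.BirchSwinnertonDyer.BirchSwinnertonDyer.Theorems.HeavyDiscriminant

/-! ## §C.1 The light door and the pigeonhole in one window -/

/-- **Light door** (the card's `door_shape`): an imaginary quadratic Heegner field `K′` of `N_W` with `|d_{K′}| > 4`,
`L(W^{(d_{K′})}, 1) ≠ 0` and `h_{K′} < 2^{ω(|d_{K′}|)−1}·p` (`p` an odd prime) witnesses the conclusion of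
`HeegnerTwistCouplingInSupply` at `(W, p)`: `p ∤ h_{K′}` by genus theory. [cite: Cox2013, §3.B Thm. 3.15] -/
theorem cruxConclusion_of_light (W : WeierstrassCurve ℚ) [W.IsElliptic] {p : ℕ} (hp : p.Prime) (hp2 : p ≠ 2)
    (K : Type) [Field K] [NumberField K] (hK : IsImaginaryQuadratic K)
    (h4 : 4 < (NumberField.discr K).natAbs) (hH : SatisfiesHeegnerHypothesis (W.conductorNorm ℤ) K)
    (hL : (W.quadraticTwist (NumberField.discr K : ℚ)).entireLFunction 1 ≠ 0)
    (hlight : NumberField.classNumber K < 2 ^ ((NumberField.discr K).natAbs.primeFactors.card - 1) * p) :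
    ∃ (K : Type) (_ : Field K) (_ : NumberField K),
      IsImaginaryQuadratic K ∧ 4 < (NumberField.discr K).natAbs ∧
        SatisfiesHeegnerHypothesis (W.conductorNorm ℤ) K ∧
        (W.quadraticTwist (NumberField.discr K : ℚ)).entireLFunction 1 ≠ 0 ∧ ¬ p ∣ NumberField.classNumber K :=
  ⟨K, inferInstance, inferInstance, hK, h4, hH, hL, not_dvd_classNumber_of_light hK hp hp2 hlight⟩

/-- **Pigeonhole in the window `[−X, −1]`.** If the `d ∈ [−X, −1]` that are discriminants of imaginary quadratic Heegner fields
of `N_W` with `|d| > 4` and `L(W^{(d)}, 1) ≠ 0` are MORE than the heavy ones (`∃ K, d_K = d, 2^{ω(|d|)−1}·p ≤ h_K`), then one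
non-vanishing Heegner `d` is light and the conclusion of the crux holds at `(W, p)` (`p` an odd prime). [folklore] -/
theorem cruxConclusion_of_card_heavy_lt_card (W : WeierstrassCurve ℚ) [W.IsElliptic] {p : ℕ} (hp : p.Prime)
    (hp2 : p ≠ 2) (X : ℕ)
    (hlt : ((Icc (-(X : ℤ)) (-1)).filter (fun d ↦
        ∃ (K : Type) (_ : Field K) (_ : NumberField K), IsImaginaryQuadratic K ∧ NumberField.discr K = d ∧
          2 ^ (d.natAbs.primeFactors.card - 1) * p ≤ NumberField.classNumber K)).card <
      ((Icc (-(X : ℤ)) (-1)).filter (fun d ↦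
        ∃ (K : Type) (_ : Field K) (_ : NumberField K), IsImaginaryQuadratic K ∧ NumberField.discr K = d ∧
          4 < d.natAbs ∧ SatisfiesHeegnerHypothesis (W.conductorNorm ℤ) K ∧
          (W.quadraticTwist (d : ℚ)).entireLFunction 1 ≠ 0)).card) :
    ∃ (K : Type) (_ : Field K) (_ : NumberField K),
      IsImaginaryQuadratic K ∧ 4 < (NumberField.discr K).natAbs ∧
        SatisfiesHeegnerHypothesis (W.conductorNorm ℤ) K ∧
        (W.quadraticTwist (NumberField.discr K : ℚ)).entireLFunction 1 ≠ 0 ∧ ¬ p ∣ NumberField.classNumber K := by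
  obtain ⟨d, hdN, hdH⟩ := exists_mem_notMem_of_card_lt_card hlt
  rw [mem_filter] at hdN hdH
  obtain ⟨hdI, K, iF, iN, hK, hdisc, h4, hH, hL⟩ := hdN
  have hlight : NumberField.classNumber K < 2 ^ ((NumberField.discr K).natAbs.primeFactors.card - 1) * p := by
    by_contra hle
    exact hdH ⟨hdI, K, iF, iN, hK, hdisc, by rw [← hdisc]; exact not_lt.mp hle⟩
  subst hdisc
  exact cruxConclusion_of_light W hp hp2 K hK h4 hH hL hlight

/-! ## §C.2 ★★ The density door -/

/-- ★★ **THE DENSITY DOOR.** For every `A ≥ 1` and `δ > 0` there is `p₂` (depending on `A, δ` only) such that for EVERY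
elliptic curve `W/ℚ` and every odd prime `p ≥ p₂`: if at least `δ·A·p²` integers `d ∈ [−A·p², −1]` are discriminants of
imaginary quadratic Heegner fields of `N_W` with `|d| > 4` and `L(W^{(d)}, 1) ≠ 0`, then there is an imaginary quadratic
Heegner field `K′` of `N_W` with `|d_{K′}| > 4`, `L(W^{(d_{K′})}, 1) ≠ 0` and `p ∤ h(K′)` — the conclusion of
`HeegnerTwistCouplingInSupply` at `(W, p)`. Proof: `heavySparse_window` with `η = δ/2` and the pigeonhole. [folklore] -/
theorem cruxConclusion_of_window_density (A : ℕ) (δ : ℝ) (hA : 1 ≤ A) (hδ : 0 < δ) :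
    ∃ p₂ : ℕ, ∀ (W : WeierstrassCurve ℚ) [W.IsElliptic] (p : ℕ), p.Prime → p ≠ 2 → p₂ ≤ p →
      δ * ((A * p ^ 2 : ℕ) : ℝ) ≤ (((Icc (-((A * p ^ 2 : ℕ) : ℤ)) (-1)).filter (fun d ↦
        ∃ (K : Type) (_ : Field K) (_ : NumberField K), IsImaginaryQuadratic K ∧ NumberField.discr K = d ∧
          4 < d.natAbs ∧ SatisfiesHeegnerHypothesis (W.conductorNorm ℤ) K ∧
          (W.quadraticTwist (d : ℚ)).entireLFunction 1 ≠ 0)).card : ℝ) →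
      ∃ (K : Type) (_ : Field K) (_ : NumberField K),
        IsImaginaryQuadratic K ∧ 4 < (NumberField.discr K).natAbs ∧
          SatisfiesHeegnerHypothesis (W.conductorNorm ℤ) K ∧
          (W.quadraticTwist (NumberField.discr K : ℚ)).entireLFunction 1 ≠ 0 ∧ ¬ p ∣ NumberField.classNumber K := by
  obtain ⟨p₀, hp₀⟩ := heavySparse_window A (δ / 2) hA (half_pos hδ)
  refine ⟨max p₀ 1, fun W _ p hp hp2 hp₂ hdense ↦ ?_⟩
  have hheavy := hp₀ p (le_trans (le_max_left _ _) hp₂)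
  have hp1 : 1 ≤ p := le_trans (le_max_right _ _) hp₂
  have hXpos : (0 : ℝ) < ((A * p ^ 2 : ℕ) : ℝ) := by
    have : 1 ≤ A * p ^ 2 := by nlinarith
    exact_mod_cast this
  refine cruxConclusion_of_card_heavy_lt_card W hp hp2 (A * p ^ 2) ?_
  have h : (((Icc (-((A * p ^ 2 : ℕ) : ℤ)) (-1)).filter (fun d ↦
        ∃ (K : Type) (_ : Field K) (_ : NumberField K), IsImaginaryQuadratic K ∧ NumberField.discr K = d ∧
          2 ^ (d.natAbs.primeFactors.card - 1) * p ≤ NumberField.classNumber K)).card : ℝ) <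
      (((Icc (-((A * p ^ 2 : ℕ) : ℤ)) (-1)).filter (fun d ↦
        ∃ (K : Type) (_ : Field K) (_ : NumberField K), IsImaginaryQuadratic K ∧ NumberField.discr K = d ∧
          4 < d.natAbs ∧ SatisfiesHeegnerHypothesis (W.conductorNorm ℤ) K ∧
          (W.quadraticTwist (d : ℚ)).entireLFunction 1 ≠ 0)).card : ℝ) := by
    nlinarith
  exact_mod_cast h

/-! ## §C.3 The card's `BulkTransfer` (absolute form) and the crux-body shape -/

/-- **Bulk transfer on a corner class** (the card's `BulkTransfer`, with the absolute form of `PropNVAtScale`): if for some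
window constant `A ≥ 1`, proportion `δ > 0` and threshold `p₁`, every pair `(W, p)` of the class `𝒞` with `p ≥ p₁` has at
least `δ·A·p²` non-vanishing Heegner discriminants of `N_W` with `|d| > 4` in `[−A·p², −1]`, then the conclusion of
`HeegnerTwistCouplingInSupply` holds at every `(W, p) ∈ 𝒞` with `p` an odd prime `≥ p₂` (some `p₂`). [folklore] -/
theorem bulkTransfer (𝒞 : WeierstrassCurve ℚ → ℕ → Prop)
    (hNV : ∃ (A : ℕ) (δ : ℝ) (p₁ : ℕ), 1 ≤ A ∧ 0 < δ ∧
      ∀ (W : WeierstrassCurve ℚ) [W.IsElliptic] (p : ℕ), 𝒞 W p → p₁ ≤ p →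
        δ * ((A * p ^ 2 : ℕ) : ℝ) ≤ (((Icc (-((A * p ^ 2 : ℕ) : ℤ)) (-1)).filter (fun d ↦
          ∃ (K : Type) (_ : Field K) (_ : NumberField K), IsImaginaryQuadratic K ∧ NumberField.discr K = d ∧
            4 < d.natAbs ∧ SatisfiesHeegnerHypothesis (W.conductorNorm ℤ) K ∧
            (W.quadraticTwist (d : ℚ)).entireLFunction 1 ≠ 0)).card : ℝ)) :
    ∃ p₂ : ℕ, ∀ (W : WeierstrassCurve ℚ) [W.IsElliptic] (p : ℕ), 𝒞 W p → p.Prime → p ≠ 2 → p₂ ≤ p →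
      ∃ (K : Type) (_ : Field K) (_ : NumberField K),
        IsImaginaryQuadratic K ∧ 4 < (NumberField.discr K).natAbs ∧
          SatisfiesHeegnerHypothesis (W.conductorNorm ℤ) K ∧
          (W.quadraticTwist (NumberField.discr K : ℚ)).entireLFunction 1 ≠ 0 ∧ ¬ p ∣ NumberField.classNumber K := by
  obtain ⟨A, δ, p₁, hA, hδ, hNV⟩ := hNV
  obtain ⟨p₂, hp₂⟩ := cruxConclusion_of_window_density A δ hA hδ
  refine ⟨max p₁ p₂, fun W _ p h𝒞 hp hp2 hle ↦ ?_⟩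
  exact hp₂ W p hp hp2 (le_trans (le_max_right _ _) hle) (hNV W p h𝒞 (le_trans (le_max_left _ _) hle))

/-- **The crux BODY in the bulk, from window density** — the conclusion of `HeegnerTwistCouplingInSupply` with its own
hypothesis list (all idle here except `[Fact p.Prime]` and `5 ≤ p`, which give an odd prime): for every `A ≥ 1`, `δ > 0`
there is `p₂` such that at every `(W, p)` of the crux's habitat with `p ≥ p₂` whose non-vanishing Heegner discriminants with
`|d| > 4` number at least `δ·A·p²` in `[−A·p², −1]`, the crux's `∃ K′ …` holds. The supply hypothesis
(`∀ B, ∃ K′ …, ¬ p ∣ h(K′)`) is not used. [folklore] -/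
theorem cruxBody_of_window_density (A : ℕ) (δ : ℝ) (hA : 1 ≤ A) (hδ : 0 < δ) :
    ∃ p₂ : ℕ, ∀ (W : WeierstrassCurve ℚ) [W.IsElliptic] [W.IsGloballyMinimal] (p : ℕ) [Fact p.Prime]
      [NeZero (W.conductorNorm ℤ)], W.HasCM → W.analyticRank = 1 → 5 ≤ p → CMInert W p → ¬ Good W p →
      (∀ B : ℕ, ∃ (K : Type) (_ : Field K) (_ : NumberField K), IsImaginaryQuadratic K ∧
        B < (NumberField.discr K).natAbs ∧ 4 < (NumberField.discr K).natAbs ∧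
        SatisfiesHeegnerHypothesis (W.conductorNorm ℤ) K ∧ ¬ p ∣ NumberField.classNumber K) →
      p₂ ≤ p →
      δ * ((A * p ^ 2 : ℕ) : ℝ) ≤ (((Icc (-((A * p ^ 2 : ℕ) : ℤ)) (-1)).filter (fun d ↦
        ∃ (K : Type) (_ : Field K) (_ : NumberField K), IsImaginaryQuadratic K ∧ NumberField.discr K = d ∧
          4 < d.natAbs ∧ SatisfiesHeegnerHypothesis (W.conductorNorm ℤ) K ∧
          (W.quadraticTwist (d : ℚ)).entireLFunction 1 ≠ 0)).card : ℝ) →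
      ∃ (K : Type) (_ : Field K) (_ : NumberField K),
        IsImaginaryQuadratic K ∧ 4 < (NumberField.discr K).natAbs ∧
          SatisfiesHeegnerHypothesis (W.conductorNorm ℤ) K ∧
          (W.quadraticTwist (NumberField.discr K : ℚ)).entireLFunction 1 ≠ 0 ∧ ¬ p ∣ NumberField.classNumber K := by
  obtain ⟨p₂, hp₂⟩ := cruxConclusion_of_window_density A δ hA hδ
  refine ⟨p₂, fun W _ _ p _ _ _ _ hp5 _ _ _ hle hdense ↦ ?_⟩
  have hp : p.Prime := Fact.out
  exact hp₂ W p hp (by rintro rfl; omega) hle hdense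

/-! ## §C.4 The card's `Nat.card` currency (appended) -/

/-- **Window set = window finset.** The card's counting set `{d : ℤ | |d| ≤ X ∧ ∃ K imaginary quadratic Heegner for N, d_K = d,
|d| > 4, L(W^{(d)},1) ≠ 0}` (its `PropNVAtScale` numerator, `Nat.card` of a set) is the coercion of this file's finset over
`[−X, −1]`: a field discriminant of an imaginary quadratic field is negative (`IsImaginaryQuadratic.discr_neg`). [folklore] -/
theorem setOf_window_eq_coe_filter (W : WeierstrassCurve ℚ) [W.IsElliptic] (X : ℕ) :
    {d : ℤ | d.natAbs ≤ X ∧ ∃ (K : Type) (_ : Field K) (_ : NumberField K), IsImaginaryQuadratic K ∧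
        NumberField.discr K = d ∧ 4 < d.natAbs ∧ SatisfiesHeegnerHypothesis (W.conductorNorm ℤ) K ∧
        (W.quadraticTwist (d : ℚ)).entireLFunction 1 ≠ 0} =
      ↑((Icc (-(X : ℤ)) (-1)).filter (fun d ↦
        ∃ (K : Type) (_ : Field K) (_ : NumberField K), IsImaginaryQuadratic K ∧ NumberField.discr K = d ∧
          4 < d.natAbs ∧ SatisfiesHeegnerHypothesis (W.conductorNorm ℤ) K ∧
          (W.quadraticTwist (d : ℚ)).entireLFunction 1 ≠ 0)) := by
  ext d
  simp only [Set.mem_setOf_eq, coe_filter, mem_Icc]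
  constructor
  · rintro ⟨hX, K, iF, iN, hK, hdisc, h4, hH, hL⟩
    have hneg : d < 0 := hdisc ▸ hK.discr_neg
    refine ⟨⟨?_, by omega⟩, K, iF, iN, hK, hdisc, h4, hH, hL⟩
    have : ((d.natAbs : ℕ) : ℤ) = -d := Int.ofNat_natAbs_of_nonpos hneg.le
    omega
  · rintro ⟨⟨hXd, hd1⟩, K, iF, iN, hK, hdisc, h4, hH, hL⟩
    refine ⟨?_, K, iF, iN, hK, hdisc, h4, hH, hL⟩
    have : ((d.natAbs : ℕ) : ℤ) = -d := Int.ofNat_natAbs_of_nonpos (by omega)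
    omega

/-- ★★ **The density door in the card's `Nat.card` currency** (`PropNVAtScale` numerator, absolute form): for every `A ≥ 1`, `δ > 0`
there is `p₂` such that for every `W/ℚ` and every odd prime `p ≥ p₂`,
`δ·A·p² ≤ Nat.card {d : ℤ | |d| ≤ A·p² ∧ ∃ K imaginary quadratic Heegner for N_W, d_K = d, |d| > 4, L(W^{(d)},1) ≠ 0}` gives the
conclusion of `HeegnerTwistCouplingInSupply` at `(W, p)`. [folklore] -/
theorem cruxConclusion_of_window_density_natCard (A : ℕ) (δ : ℝ) (hA : 1 ≤ A) (hδ : 0 < δ) :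
    ∃ p₂ : ℕ, ∀ (W : WeierstrassCurve ℚ) [W.IsElliptic] (p : ℕ), p.Prime → p ≠ 2 → p₂ ≤ p →
      δ * ((A * p ^ 2 : ℕ) : ℝ) ≤ (Nat.card {d : ℤ | d.natAbs ≤ A * p ^ 2 ∧
        ∃ (K : Type) (_ : Field K) (_ : NumberField K), IsImaginaryQuadratic K ∧
          NumberField.discr K = d ∧ 4 < d.natAbs ∧ SatisfiesHeegnerHypothesis (W.conductorNorm ℤ) K ∧
          (W.quadraticTwist (d : ℚ)).entireLFunction 1 ≠ 0} : ℝ) →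
      ∃ (K : Type) (_ : Field K) (_ : NumberField K),
        IsImaginaryQuadratic K ∧ 4 < (NumberField.discr K).natAbs ∧
          SatisfiesHeegnerHypothesis (W.conductorNorm ℤ) K ∧
          (W.quadraticTwist (NumberField.discr K : ℚ)).entireLFunction 1 ≠ 0 ∧ ¬ p ∣ NumberField.classNumber K := by
  obtain ⟨p₂, hp₂⟩ := cruxConclusion_of_window_density A δ hA hδ
  refine ⟨p₂, fun W _ p hp hp2 hle hdense ↦ hp₂ W p hp hp2 hle ?_⟩
  rwa [setOf_window_eq_coe_filter W (A * p ^ 2), Nat.card_coe_set_eq, Set.ncard_coe_finset] at hdense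

end Summit.BirchSwinnertonDyer.BirchSwinnertonDyer.Theorems.HeavyDiscriminant

end
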